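import Summits.AtomisticToContinuum.BoseEinsteinCondensation.Theorems.BECHardSphereReductionHardSphereBECStubSectorTransferPrelims
import HarnessLib

/-!
# Crux `HardSphereBEC` (stmt-AtomisticToContinuum-11885), line `birth` (skeleton v5):
# the registered stub `stub_sectorTransfer_of` (T3)

Supports (does not close) stmt-AtomisticToContinuum-11885; stub `stub_sectorTransfer_of` of the
birth line (lead c8, skeleton v5). **The phase-sector positivity transfer** (the `ε/τ` bookkeeping):
GIVEN the four-sector occupation inequality (T1's statement) and the smoothed sectors (T2's
statement), at fixed `(v, N, L, c, δ₁)` with `c > 1/2`, `L > 0`, `E₀ = groundStateEnergy v N L ≠ ⊤`,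
`δ₁ > 0`: if every NONNEGATIVE `δ₁`-near-minimiser `Φ` has `occ₀(Φ) ≥ cN` (flat mode
`φ₀ = L^{-3/2}·1_{Λ_L}`), then for some `δ₂ > 0` EVERY `δ₂`-near-minimiser `Ψ` has
`occ₀(Ψ) ≥ (c − 1/2)N`.

Proof (helpers in namespace `SectorTransfer`, the analytic ones in the `…Prelims` file).
Constants: `κ = c − 1/2`, `τ = κ/(16c)`, `d = (min δ₁ 1).toReal`, `e = E₀.toReal`,
`V = |Λ_L^N|` (finite), `ε = τd/(4(e+1)(4V+1))`, `δ₂ = τd/4`. For a `δ₂`-near-minimiser `Ψ` take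
the smoothed sectors `G_j` of T2 at level `ε`, with masses `A_j = ∫|G_j|²` and raw energies
`R_j = ∫(|∇G_j|² + V|G_j|²)`.
(1) `Σ_j R_j ≤ energy Ψ ≤ E₀ + δ₂` (domination in sum; only superadditivity of `∫⁻`).
(2) Normalising `G_j` (`A_j ≠ 0`) gives a nonnegative trial state `Φ_j = A_j^{-1/2} G_j` with
`energy Φ_j = A_j⁻¹ R_j`, so `E₀ A_j ≤ R_j` (variational principle) and
`occ₀(Φ_j) = A_j⁻¹ occ₀(G_j)` (homogeneity).
(3) Mass deficit: `P_j² − G_j² ≤ ε(1 + P_j²)` pointwise and `Σ_j P_j² = |Ψ|²`, so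
`1 ≤ Σ_j A_j + ε(4V + 1)`; hence for a sector with `A_j ≥ τ`:
`R_j ≤ E₀A_j + E₀ ε(4V+1) + δ₂ ≤ E₀ A_j + τd/2 ≤ A_j (E₀ + min δ₁ 1)`, i.e. `Φ_j` is a nonnegative
`δ₁`-near-minimiser and the hypothesis gives `A_j · cN ≤ occ₀(G_j) ≤ occ₀(P_j)` (monotonicity of the
flat-mode occupation in a real nonnegative function, `0 ≤ G_j ≤ P_j`).
(4) Summing (small sectors contribute `≤ τ cN` each) and using T1 (`2Σ_j occ₀(P_j) ≤ occ₀(Ψ) + N`):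
`2cN ≤ occ₀(Ψ) + N + 8τcN + 2ε(4V+1)cN`, and `8τc + 2ε(4V+1)c ≤ κ/2 + κ/32 < κ` gives
`(c − 1/2)N ≤ occ₀(Ψ)`.
-/

noncomputable section

open MeasureTheory
open scoped ENNReal NNReal ComplexConjugate

namespace Summit.AtomisticToContinuum.BoseEinsteinCondensation.Cruxes.HardSphereBEC.Birth

open Literature.MathematicalPhysics.QuantumManyBody.BoseGas

namespace SectorTransfer

/-! ### Bookkeeping -/

/-- **Slack of a sector** (pure `ℝ≥0∞` bookkeeping): from `Σ_i R_i ≤ E₀ + δ₂`, `E₀ A_i ≤ R_i`,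
`1 ≤ Σ_i A_i + D` (with `A_i`, `E₀` finite): `R_j ≤ E₀ A_j + E₀ D + δ₂`. [folklore] -/
theorem rawEnergy_le_of_sum {E₀ δ₂ D : ℝ≥0∞} {A R : Fin 4 → ℝ≥0∞} (hE₀ : E₀ ≠ ⊤)
    (hAtop : ∀ i, A i ≠ ⊤) (hRsum : ∑ i, R i ≤ E₀ + δ₂) (hvar : ∀ i, E₀ * A i ≤ R i)
    (hdef : 1 ≤ ∑ i, A i + D) (j : Fin 4) : R j ≤ E₀ * A j + E₀ * D + δ₂ := by
  have h1 : R j + ∑ i ∈ Finset.univ.erase j, E₀ * A i ≤ ∑ i, R i := by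
    rw [← Finset.add_sum_erase Finset.univ R (Finset.mem_univ j)]
    exact add_le_add le_rfl (Finset.sum_le_sum fun i _ => hvar i)
  have h2 : E₀ + δ₂ ≤ E₀ * A j + E₀ * D + δ₂ + ∑ i ∈ Finset.univ.erase j, E₀ * A i :=
    calc E₀ + δ₂ = E₀ * 1 + δ₂ := by rw [mul_one]
      _ ≤ E₀ * (∑ i, A i + D) + δ₂ := by gcongr
      _ = E₀ * A j + E₀ * D + δ₂ + ∑ i ∈ Finset.univ.erase j, E₀ * A i := by
          rw [← Finset.add_sum_erase Finset.univ A (Finset.mem_univ j), mul_add, mul_add,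
            Finset.mul_sum]
          ring
  have hfin : ∑ i ∈ Finset.univ.erase j, E₀ * A i ≠ ⊤ :=
    ENNReal.sum_ne_top.2 fun i _ => ENNReal.mul_ne_top hE₀ (hAtop i)
  exact ENNReal.le_of_add_le_add_right hfin ((h1.trans hRsum).trans h2)

/-- **Final bookkeeping** (pure arithmetic): from T1 (`2P ≤ O + N`), the sector sum
(`S·cN ≤ P + 4τcN`), the mass deficit (`1 ≤ S + D`) and `8τc + 2Dc ≤ c − 1/2`:
`(c − 1/2) N ≤ O`. [folklore] -/
theorem final_bound {O P S : ℝ≥0∞} {N : ℕ} {c τ D : ℝ} (hτ : 0 ≤ τ) (hD : 0 ≤ D)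
    (hc : 1 / 2 < c) (hkey : 8 * (τ * c) + 2 * (D * c) ≤ c - 1 / 2) (hT1 : 2 * P ≤ O + N)
    (hsum : S * ENNReal.ofReal (c * N) ≤
      P + 4 * (ENNReal.ofReal τ * ENNReal.ofReal (c * N)))
    (hdef : 1 ≤ S + ENNReal.ofReal D) : ENNReal.ofReal ((c - 1 / 2) * N) ≤ O := by
  have hc0 : 0 ≤ c := by linarith
  have hN0 : (0 : ℝ) ≤ N := N.cast_nonneg
  -- the chain in `ℝ≥0∞`
  have hchain : 2 * ENNReal.ofReal (c * N) ≤
      O + ((N : ℝ≥0∞) + 8 * (ENNReal.ofReal τ * ENNReal.ofReal (c * N)) +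
        2 * (ENNReal.ofReal D * ENNReal.ofReal (c * N))) :=
    calc 2 * ENNReal.ofReal (c * N) = 2 * (1 * ENNReal.ofReal (c * N)) := by rw [one_mul]
      _ ≤ 2 * ((S + ENNReal.ofReal D) * ENNReal.ofReal (c * N)) := by gcongr
      _ = 2 * (S * ENNReal.ofReal (c * N)) + 2 * (ENNReal.ofReal D * ENNReal.ofReal (c * N)) := by
          rw [add_mul, mul_add]
      _ ≤ 2 * (P + 4 * (ENNReal.ofReal τ * ENNReal.ofReal (c * N))) +
            2 * (ENNReal.ofReal D * ENNReal.ofReal (c * N)) := by gcongr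
      _ = 2 * P + (8 * (ENNReal.ofReal τ * ENNReal.ofReal (c * N)) +
            2 * (ENNReal.ofReal D * ENNReal.ofReal (c * N))) := by ring
      _ ≤ O + N + (8 * (ENNReal.ofReal τ * ENNReal.ofReal (c * N)) +
            2 * (ENNReal.ofReal D * ENNReal.ofReal (c * N))) := add_le_add hT1 le_rfl
      _ = _ := by ring
  -- everything but `O` is a finite real
  have hb0 : 0 ≤ (N : ℝ) + 8 * (τ * (c * N)) + 2 * (D * (c * N)) := by positivity
  have hbe : (N : ℝ≥0∞) + 8 * (ENNReal.ofReal τ * ENNReal.ofReal (c * N)) +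
      2 * (ENNReal.ofReal D * ENNReal.ofReal (c * N)) =
      ENNReal.ofReal ((N : ℝ) + 8 * (τ * (c * N)) + 2 * (D * (c * N))) := by
    rw [ENNReal.ofReal_add (by positivity) (by positivity),
      ENNReal.ofReal_add (by positivity) (by positivity), ENNReal.ofReal_natCast,
      ENNReal.ofReal_mul (by norm_num : (0 : ℝ) ≤ 8), ENNReal.ofReal_ofNat,
      ENNReal.ofReal_mul hτ, ENNReal.ofReal_mul (by norm_num : (0 : ℝ) ≤ 2), ENNReal.ofReal_ofNat,
      ENNReal.ofReal_mul hD]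
  have h2C : 2 * ENNReal.ofReal (c * N) = ENNReal.ofReal (2 * (c * N)) := by
    rw [ENNReal.ofReal_mul (by norm_num : (0 : ℝ) ≤ 2), ENNReal.ofReal_ofNat]
  have hreal : (c - 1 / 2) * N + ((N : ℝ) + 8 * (τ * (c * N)) + 2 * (D * (c * N))) ≤
      2 * (c * N) := by
    nlinarith [mul_le_mul_of_nonneg_left hkey hN0]
  rw [hbe, h2C] at hchain
  refine ENNReal.le_of_add_le_add_right
    (a := ENNReal.ofReal ((N : ℝ) + 8 * (τ * (c * N)) + 2 * (D * (c * N)))) ENNReal.ofReal_ne_top ?_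
  calc ENNReal.ofReal ((c - 1 / 2) * N) +
        ENNReal.ofReal ((N : ℝ) + 8 * (τ * (c * N)) + 2 * (D * (c * N)))
      = ENNReal.ofReal ((c - 1 / 2) * N + ((N : ℝ) + 8 * (τ * (c * N)) + 2 * (D * (c * N)))) :=
        (ENNReal.ofReal_add (mul_nonneg (by linarith) hN0) hb0).symm
    _ ≤ ENNReal.ofReal (2 * (c * N)) := ENNReal.ofReal_le_ofReal hreal
    _ ≤ _ := hchain

end SectorTransfer

open SectorTransfer in
/-- **T3 — THE PHASE-SECTOR POSITIVITY TRANSFER FROM T1 AND T2** (every pair potential `v`, every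
`(N, L)` with `L > 0` and `E₀(v, N, L) < ⊤`; no rigidity, no connectedness): GIVEN the four-sector
occupation inequality (T1's statement) and the smoothed sectors (T2's statement), if `c > 1/2` and
every NONNEGATIVE `δ₁`-near-minimiser `Φ` has `occ₀(Φ) ≥ cN`, then for some `δ₂ > 0` EVERY
`δ₂`-near-minimiser `Ψ` has `occ₀(Ψ) ≥ (c − 1/2)N`. With `κ = c − 1/2`, `τ = κ/(16c)`,
`d = (min δ₁ 1).toReal`, `e = E₀.toReal`, `V = |Λ_L^N|`, `ε = τd/(4(e+1)(4V+1))`, `δ₂ = τd/4`: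
the smoothed sectors `G_j` of T2 (level `ε`) with mass `A_j = ∫G_j² ≥ τ`, normalised, are
nonnegative `δ₁`-near-minimisers — their raw energies add up to at most `energy Ψ ≤ E₀ + δ₂` while
each is at least `E₀ A_j`, and `Σ_j A_j ≥ 1 − ε(4V + 1)`; so `occ₀(P_j) ≥ occ₀(G_j) ≥ cN A_j` there
(`φ₀ ≥ 0`, `0 ≤ G_j ≤ P_j`); summing and using T1,
`occ₀(Ψ) + N ≥ 2cN(1 − 4τ − ε(4V+1)) ≥ (c + 1/2)N`. [folklore] -/
theorem stub_sectorTransfer_of :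
    (∀ (N : ℕ) (L : ℝ), 0 < L → ∀ Θ : Literature.MathematicalPhysics.QuantumManyBody.BoseGas.Config N → ℂ, Continuous Θ → (∀ X, X ∉ Literature.MathematicalPhysics.QuantumManyBody.BoseGas.boxN N L → Θ X = 0) → 2 * (Literature.MathematicalPhysics.QuantumManyBody.BoseGas.occupation N ((Literature.MathematicalPhysics.QuantumManyBody.BoseGas.box L).indicator fun _ => ((Real.sqrt (L ^ 3))⁻¹ : ℂ)) (fun X => ((max (Θ X).re 0 : ℝ) : ℂ)) + Literature.MathematicalPhysics.QuantumManyBody.BoseGas.occupation N ((Literature.MathematicalPhysics.QuantumManyBody.BoseGas.box L).indicator fun _ => ((Real.sqrt (L ^ 3))⁻¹ : ℂ)) (fun X => ((max (-(Θ X).re) 0 : ℝ) : ℂ)) + Literature.MathematicalPhysics.QuantumManyBody.BoseGas.occupation N ((Literature.MathematicalPhysics.QuantumManyBody.BoseGas.box L).indicator fun _ => ((Real.sqrt (L ^ 3))⁻¹ : ℂ)) (fun X => ((max (Θ X).im 0 : ℝ) : ℂ)) + Literature.MathematicalPhysics.QuantumManyBody.BoseGas.occupation N ((Literature.MathematicalPhysics.QuantumManyBody.BoseGas.box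 L).indicator fun _ => ((Real.sqrt (L ^ 3))⁻¹ : ℂ)) (fun X => ((max (-(Θ X).im) 0 : ℝ) : ℂ))) ≤ Literature.MathematicalPhysics.QuantumManyBody.BoseGas.occupation N ((Literature.MathematicalPhysics.QuantumManyBody.BoseGas.box L).indicator fun _ => ((Real.sqrt (L ^ 3))⁻¹ : ℂ)) Θ + (N : ENNReal) * ∫⁻ X, (‖Θ X‖₊ : ENNReal) ^ 2) → (∀ (N : ℕ) (L : ℝ) (Ψ : Literature.MathematicalPhysics.QuantumManyBody.BoseGas.TrialState N L) (ε : ℝ), 0 < ε → ∃ G : Fin 4 → (Literature.MathematicalPhysics.QuantumManyBody.BoseGas.Config N → ℂ), (∀ j, ContDiff ℝ 1 (G j)) ∧ (∀ j X, Ψ.ψ X = 0 → G j X = 0) ∧ (∀ j (σ : Equiv.Perm (Fin N)) X, G j (X ∘ σ) = G j X) ∧ (∀ j X, G j X = (‖G j X‖ : ℂ)) ∧ (∀ X, ∑ j, Literature.MathematicalPhysics.QuantumManyBody.BoseGas.kineticDensity (G j) X ≤ Literature.MathematicalPhysics.QuantumManyBody.BoseGas.kineticDensity Ψ.ψ X)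 ∧ (∀ X, ∑ j, (‖G j X‖₊ : ENNReal) ^ 2 ≤ (‖Ψ.ψ X‖₊ : ENNReal) ^ 2) ∧ (∀ X, ‖G 0 X‖ ≤ max (Ψ.ψ X).re 0 ∧ max (Ψ.ψ X).re 0 ≤ ‖G 0 X‖ + ε) ∧ (∀ X, ‖G 1 X‖ ≤ max (-(Ψ.ψ X).re) 0 ∧ max (-(Ψ.ψ X).re) 0 ≤ ‖G 1 X‖ + ε) ∧ (∀ X, ‖G 2 X‖ ≤ max (Ψ.ψ X).im 0 ∧ max (Ψ.ψ X).im 0 ≤ ‖G 2 X‖ + ε) ∧ (∀ X, ‖G 3 X‖ ≤ max (-(Ψ.ψ X).im) 0 ∧ max (-(Ψ.ψ X).im) 0 ≤ ‖G 3 X‖ + ε)) → ∀ (v : ℝ → ENNReal) (N : ℕ) (L : ℝ) (c : ℝ) (δ₁ : ENNReal), 1 / 2 < c → 0 < L → Literature.MathematicalPhysics.QuantumManyBody.BoseGas.groundStateEnergy v N L ≠ ⊤ → 0 < δ₁ → (∀ Φ : Literature.MathematicalPhysics.QuantumManyBody.BoseGas.TrialState N L, Literature.MathematicalPhysics.QuantumManyBody.BoseGas.energy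 v Φ ≤ Literature.MathematicalPhysics.QuantumManyBody.BoseGas.groundStateEnergy v N L + δ₁ → (∀ X, Φ.ψ X = (‖Φ.ψ X‖ : ℂ)) → ENNReal.ofReal (c * N) ≤ Literature.MathematicalPhysics.QuantumManyBody.BoseGas.occupation N ((Literature.MathematicalPhysics.QuantumManyBody.BoseGas.box L).indicator fun _ => ((Real.sqrt (L ^ 3))⁻¹ : ℂ)) Φ.ψ) → ∃ δ₂ : ENNReal, 0 < δ₂ ∧ ∀ Ψ : Literature.MathematicalPhysics.QuantumManyBody.BoseGas.TrialState N L, Literature.MathematicalPhysics.QuantumManyBody.BoseGas.energy v Ψ ≤ Literature.MathematicalPhysics.QuantumManyBody.BoseGas.groundStateEnergy v N L + δ₂ → ENNReal.ofReal ((c - 1 / 2) * N) ≤ Literature.MathematicalPhysics.QuantumManyBody.BoseGas.occupation N ((Literature.MathematicalPhysics.QuantumManyBody.BoseGas.box L).indicator fun _ => ((Real.sqrt (L ^ 3))⁻¹ : ℂ)) Ψ.ψ := by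
  intro hT1 hT2 v N L c δ₁ hc hL hE₀ hδ₁ HYP
  -- the constants `κ = c - 1/2`, `τ = κ/(16c)`, `d`, `e`, `V`, `ε`, `δ₂ = τd/4`
  have hκ : 0 < c - 1 / 2 := by linarith
  have hc0 : 0 < c := by linarith
  obtain ⟨τ, hτ⟩ : ∃ τ : ℝ, τ = (c - 1 / 2) / (16 * c) := ⟨_, rfl⟩
  have hτ0 : 0 < τ := by
    rw [hτ]
    positivity
  have hτc : τ * c = (c - 1 / 2) / 16 := by
    rw [hτ, div_mul_eq_mul_div, div_eq_div_iff (by positivity) (by norm_num)]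
    ring
  have hδtop : min δ₁ 1 ≠ ⊤ := ne_top_of_le_ne_top ENNReal.one_ne_top (min_le_right _ _)
  obtain ⟨d, hd⟩ : ∃ d : ℝ, d = (min δ₁ 1).toReal := ⟨_, rfl⟩
  have hd0 : 0 < d := by
    rw [hd]
    exact ENNReal.toReal_pos (lt_min hδ₁ one_pos).ne' hδtop
  have hd1 : d ≤ 1 := by
    rw [hd]
    simpa using ENNReal.toReal_mono ENNReal.one_ne_top (min_le_right δ₁ 1)
  have hδd : ENNReal.ofReal d = min δ₁ 1 := by rw [hd, ENNReal.ofReal_toReal hδtop]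
  obtain ⟨e, he⟩ : ∃ e : ℝ, e = (groundStateEnergy v N L).toReal := ⟨_, rfl⟩
  have he0 : 0 ≤ e := by
    rw [he]
    exact ENNReal.toReal_nonneg
  have hEe : groundStateEnergy v N L = ENNReal.ofReal e := by rw [he, ENNReal.ofReal_toReal hE₀]
  obtain ⟨V, hV⟩ : ∃ V : ℝ, V = (volume (boxN N L)).toReal := ⟨_, rfl⟩
  have hV0 : 0 ≤ V := by
    rw [hV]
    exact ENNReal.toReal_nonneg
  have hVe : volume (boxN N L) = ENNReal.ofReal V := by
    rw [hV, ENNReal.ofReal_toReal (volume_boxN_lt_top N L).ne]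
  obtain ⟨ε, hε⟩ : ∃ ε : ℝ, ε = τ * d / (4 * (e + 1) * (4 * V + 1)) := ⟨_, rfl⟩
  have hε0 : 0 < ε := by
    rw [hε]
    positivity
  have hXdef : ε * (4 * V + 1) * (4 * (e + 1)) = τ * d := by
    have h1 : (4 : ℝ) * (e + 1) * (4 * V + 1) ≠ 0 := by positivity
    rw [hε, div_mul_eq_mul_div, div_mul_eq_mul_div, div_eq_iff h1]
    ring
  have hX0 : 0 ≤ ε * (4 * V + 1) := by positivity
  have heX : e * (ε * (4 * V + 1)) ≤ τ * d / 4 := by nlinarith [hXdef, hX0]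
  have hX4 : ε * (4 * V + 1) ≤ τ / 4 := by
    nlinarith [hXdef, mul_nonneg hX0 he0, mul_le_mul_of_nonneg_left hd1 hτ0.le]
  have hτd : 0 ≤ τ * d := by positivity
  refine ⟨ENNReal.ofReal (τ * d / 4), ENNReal.ofReal_pos.2 (by positivity), fun Ψ hΨ => ?_⟩
  -- the smoothed sectors of `Ψ` at level `ε` (T2)
  obtain ⟨G, hGC, hG0, hGsymm, hGreal, hkin, hsq, h0, h1, h2, h3⟩ := hT2 N L Ψ ε hε0
  have hGc : ∀ j, Continuous (G j) := fun j => (hGC j).continuous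
  -- masses `A_j = ∫|G_j|²`: in sum at most one
  have hS1 : ∑ j, ∫⁻ X, ((‖G j X‖₊ : ℝ≥0∞)) ^ 2 ≤ 1 :=
    calc ∑ j, ∫⁻ X, ((‖G j X‖₊ : ℝ≥0∞)) ^ 2 ≤ ∫⁻ X, ∑ j, ((‖G j X‖₊ : ℝ≥0∞)) ^ 2 :=
        sum_four_lintegral_le _
      _ ≤ ∫⁻ X, ((‖Ψ.ψ X‖₊ : ℝ≥0∞)) ^ 2 := lintegral_mono hsq
      _ = 1 := Ψ.norm_eq
  have hAtop : ∀ j, ∫⁻ X, ((‖G j X‖₊ : ℝ≥0∞)) ^ 2 ≠ ⊤ := fun j =>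
    ne_top_of_le_ne_top ENNReal.one_ne_top
      ((Finset.single_le_sum (f := fun i => ∫⁻ X, ((‖G i X‖₊ : ℝ≥0∞)) ^ 2) (fun i _ => bot_le)
        (Finset.mem_univ j)).trans hS1)
  -- (1) the raw energies `R_j` add up below `energy Ψ ≤ E₀ + δ₂`
  have hRsum := (sum_rawEnergy_le_energy v Ψ hkin hsq).trans hΨ
  -- (2) variational bounds `E₀ A_j ≤ R_j`
  have hvar : ∀ j, groundStateEnergy v N L * ∫⁻ X, ((‖G j X‖₊ : ℝ≥0∞)) ^ 2 ≤
      ∫⁻ X, (kineticDensity (G j) X + interaction v X * ((‖G j X‖₊ : ℝ≥0∞)) ^ 2) := fun j =>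
    groundStateEnergy_mul_mass_le v Ψ (hGC j) (hG0 j) (hGsymm j) (hGreal j) (hAtop j)
  -- (3) the mass deficit `1 ≤ Σ_j A_j + ε(4V + 1)`
  have hdef : 1 ≤ (∑ j, ∫⁻ X, ((‖G j X‖₊ : ℝ≥0∞)) ^ 2) + ENNReal.ofReal (ε * (4 * V + 1)) := by
    have hconv : ENNReal.ofReal (ε * (4 * V + 1)) =
        ENNReal.ofReal ε * (4 * volume (boxN N L) + 1) := by
      rw [ENNReal.ofReal_mul hε0.le, ENNReal.ofReal_add (by positivity) zero_le_one,
        ENNReal.ofReal_one, ENNReal.ofReal_mul (by norm_num : (0 : ℝ) ≤ 4), ENNReal.ofReal_ofNat,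
        hVe]
    rw [hconv]
    exact one_le_sum_mass_add Ψ hε0.le hGc h0 h1 h2 h3
  -- (3') big sectors (`A_j ≥ τ`) are, normalised, nonnegative `δ₁`-near-minimisers: transfer
  have hbig : ∀ j, ENNReal.ofReal τ ≤ ∫⁻ X, ((‖G j X‖₊ : ℝ≥0∞)) ^ 2 →
      (∫⁻ X, ((‖G j X‖₊ : ℝ≥0∞)) ^ 2) * ENNReal.ofReal (c * N) ≤
        occupation N ((box L).indicator fun _ => ((Real.sqrt (L ^ 3))⁻¹ : ℂ)) (G j) := by
    intro j hτA
    have hA0 : ∫⁻ X, ((‖G j X‖₊ : ℝ≥0∞)) ^ 2 ≠ 0 :=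
      ((ENNReal.ofReal_pos.2 hτ0).trans_le hτA).ne'
    refine mass_mul_le_occupation v Ψ (hGC j) (hG0 j) (hGsymm j) (hGreal j) hA0 (hAtop j) _
      (δ := min δ₁ 1)
      (fun Φ hΦ hΦpos => HYP Φ (hΦ.trans (add_le_add le_rfl (min_le_left _ _))) hΦpos) ?_
    -- the slack: `R_j ≤ E₀ A_j + E₀ ε(4V+1) + δ₂ ≤ A_j (E₀ + min δ₁ 1)`
    have hsl : ∫⁻ X, (kineticDensity (G j) X + interaction v X * ((‖G j X‖₊ : ℝ≥0∞)) ^ 2) ≤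
        groundStateEnergy v N L * (∫⁻ X, ((‖G j X‖₊ : ℝ≥0∞)) ^ 2) +
          groundStateEnergy v N L * ENNReal.ofReal (ε * (4 * V + 1)) +
          ENNReal.ofReal (τ * d / 4) :=
      rawEnergy_le_of_sum (A := fun i => ∫⁻ X, ((‖G i X‖₊ : ℝ≥0∞)) ^ 2)
        (R := fun i => ∫⁻ X, (kineticDensity (G i) X +
          interaction v X * ((‖G i X‖₊ : ℝ≥0∞)) ^ 2))
        hE₀ hAtop hRsum hvar hdef j
    have hrest : groundStateEnergy v N L * ENNReal.ofReal (ε * (4 * V + 1)) +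
        ENNReal.ofReal (τ * d / 4) ≤ (∫⁻ X, ((‖G j X‖₊ : ℝ≥0∞)) ^ 2) * min δ₁ 1 :=
      calc groundStateEnergy v N L * ENNReal.ofReal (ε * (4 * V + 1)) +
            ENNReal.ofReal (τ * d / 4)
          = ENNReal.ofReal (e * (ε * (4 * V + 1)) + τ * d / 4) := by
            rw [hEe, ← ENNReal.ofReal_mul he0,
              ENNReal.ofReal_add (by positivity) (by positivity)]
        _ ≤ ENNReal.ofReal (τ * d) := ENNReal.ofReal_le_ofReal (by linarith)
        _ = ENNReal.ofReal τ * min δ₁ 1 := by rw [ENNReal.ofReal_mul hτ0.le, hδd]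
        _ ≤ _ := mul_le_mul' hτA le_rfl
    calc ∫⁻ X, (kineticDensity (G j) X + interaction v X * ((‖G j X‖₊ : ℝ≥0∞)) ^ 2)
        ≤ _ := hsl
      _ = groundStateEnergy v N L * (∫⁻ X, ((‖G j X‖₊ : ℝ≥0∞)) ^ 2) +
          (groundStateEnergy v N L * ENNReal.ofReal (ε * (4 * V + 1)) +
            ENNReal.ofReal (τ * d / 4)) := add_assoc _ _ _
      _ ≤ groundStateEnergy v N L * (∫⁻ X, ((‖G j X‖₊ : ℝ≥0∞)) ^ 2) +
          (∫⁻ X, ((‖G j X‖₊ : ℝ≥0∞)) ^ 2) * min δ₁ 1 := add_le_add le_rfl hrest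
      _ = _ := by ring
  -- (4) every sector: `A_j · cN ≤ occ₀(G_j) + τ cN`
  have hj : ∀ j, (∫⁻ X, ((‖G j X‖₊ : ℝ≥0∞)) ^ 2) * ENNReal.ofReal (c * N) ≤
      occupation N ((box L).indicator fun _ => ((Real.sqrt (L ^ 3))⁻¹ : ℂ)) (G j) +
        ENNReal.ofReal τ * ENNReal.ofReal (c * N) := by
    intro j
    rcases le_or_gt (ENNReal.ofReal τ) (∫⁻ X, ((‖G j X‖₊ : ℝ≥0∞)) ^ 2) with hτA | hτA
    · exact (hbig j hτA).trans le_self_add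
    · exact (mul_le_mul' hτA.le le_rfl).trans le_add_self
  -- (5) monotonicity `occ₀(G_j) ≤ occ₀(P_j)` in the four sectors
  have hre : Continuous fun X => (Ψ.ψ X).re := Complex.continuous_re.comp Ψ.contDiff.continuous
  have him : Continuous fun X => (Ψ.ψ X).im := Complex.continuous_im.comp Ψ.contDiff.continuous
  have hm0 : occupation N ((box L).indicator fun _ => ((Real.sqrt (L ^ 3))⁻¹ : ℂ)) (G 0) ≤
      occupation N ((box L).indicator fun _ => ((Real.sqrt (L ^ 3))⁻¹ : ℂ))
        (fun X => ((max (Ψ.ψ X).re 0 : ℝ) : ℂ)) :=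
    occupation_flatMode_mono (p := fun X => max (Ψ.ψ X).re 0) hL (hGc 0)
      (hre.max continuous_const) (hGreal 0) (fun X => (h0 X).1)
      fun X hX => by simp only [Ψ.eq_zero X hX, Complex.zero_re, max_self]
  have hm1 : occupation N ((box L).indicator fun _ => ((Real.sqrt (L ^ 3))⁻¹ : ℂ)) (G 1) ≤
      occupation N ((box L).indicator fun _ => ((Real.sqrt (L ^ 3))⁻¹ : ℂ))
        (fun X => ((max (-(Ψ.ψ X).re) 0 : ℝ) : ℂ)) :=
    occupation_flatMode_mono (p := fun X => max (-(Ψ.ψ X).re) 0) hL (hGc 1)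
      (hre.neg.max continuous_const) (hGreal 1) (fun X => (h1 X).1)
      fun X hX => by simp only [Ψ.eq_zero X hX, Complex.zero_re, neg_zero, max_self]
  have hm2 : occupation N ((box L).indicator fun _ => ((Real.sqrt (L ^ 3))⁻¹ : ℂ)) (G 2) ≤
      occupation N ((box L).indicator fun _ => ((Real.sqrt (L ^ 3))⁻¹ : ℂ))
        (fun X => ((max (Ψ.ψ X).im 0 : ℝ) : ℂ)) :=
    occupation_flatMode_mono (p := fun X => max (Ψ.ψ X).im 0) hL (hGc 2)
      (him.max continuous_const) (hGreal 2) (fun X => (h2 X).1)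
      fun X hX => by simp only [Ψ.eq_zero X hX, Complex.zero_im, max_self]
  have hm3 : occupation N ((box L).indicator fun _ => ((Real.sqrt (L ^ 3))⁻¹ : ℂ)) (G 3) ≤
      occupation N ((box L).indicator fun _ => ((Real.sqrt (L ^ 3))⁻¹ : ℂ))
        (fun X => ((max (-(Ψ.ψ X).im) 0 : ℝ) : ℂ)) :=
    occupation_flatMode_mono (p := fun X => max (-(Ψ.ψ X).im) 0) hL (hGc 3)
      (him.neg.max continuous_const) (hGreal 3) (fun X => (h3 X).1)
      fun X hX => by simp only [Ψ.eq_zero X hX, Complex.zero_im, neg_zero, max_self]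
  -- (6) summing over the sectors
  have hsum : (∑ j, ∫⁻ X, ((‖G j X‖₊ : ℝ≥0∞)) ^ 2) * ENNReal.ofReal (c * N) ≤
      occupation N ((box L).indicator fun _ => ((Real.sqrt (L ^ 3))⁻¹ : ℂ))
          (fun X => ((max (Ψ.ψ X).re 0 : ℝ) : ℂ)) +
        occupation N ((box L).indicator fun _ => ((Real.sqrt (L ^ 3))⁻¹ : ℂ))
          (fun X => ((max (-(Ψ.ψ X).re) 0 : ℝ) : ℂ)) +
        occupation N ((box L).indicator fun _ => ((Real.sqrt (L ^ 3))⁻¹ : ℂ))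
          (fun X => ((max (Ψ.ψ X).im 0 : ℝ) : ℂ)) +
        occupation N ((box L).indicator fun _ => ((Real.sqrt (L ^ 3))⁻¹ : ℂ))
          (fun X => ((max (-(Ψ.ψ X).im) 0 : ℝ) : ℂ)) +
        4 * (ENNReal.ofReal τ * ENNReal.ofReal (c * N)) := by
    rw [Finset.sum_mul, Fin.sum_univ_four]
    have e0 := (hj 0).trans (add_le_add hm0 le_rfl)
    have e1 := (hj 1).trans (add_le_add hm1 le_rfl)
    have e2 := (hj 2).trans (add_le_add hm2 le_rfl)
    have e3 := (hj 3).trans (add_le_add hm3 le_rfl)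
    calc _ ≤ _ := add_le_add (add_le_add (add_le_add e0 e1) e2) e3
      _ = _ := by ring
  -- (7) T1 for `Ψ`, and the final arithmetic
  have hT1' := hT1 N L hL Ψ.ψ Ψ.contDiff.continuous Ψ.eq_zero
  rw [Ψ.norm_eq, mul_one] at hT1'
  have hkey : 8 * (τ * c) + 2 * (ε * (4 * V + 1) * c) ≤ c - 1 / 2 := by
    nlinarith [mul_le_mul_of_nonneg_right hX4 hc0.le]
  exact final_bound hτ0.le hX0 hc hkey hT1' hsum hdef

end Summit.AtomisticToContinuum.BoseEinsteinCondensation.Cruxes.HardSphereBEC.Birth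

end
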